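import Literature.InformationTheory.QuantumCodes.ConcatenationBadnessProbability
import HarnessLib

/-!
# Hierarchical (level-by-level) decoding of a concatenated single-error-correcting block fails only on BAD fault patterns:
# the code-capacity threshold `ε₀ = 1/C(n,2)` as a theorem about an explicit recursive decoder

Topic `Literature/InformationTheory/QuantumCodes` (continues `ConcatenationBadnessRecursion.lean` / `ConcatenationBadnessProbability.lean`).
Aliferis–Gottesman–Preskill (2006, §3.2) define the ideal level-`k` decoder recursively: "it is realized by first applying the
`(k-1)`-decoder to each of the `(k-1)`-subblocks, and then applying the `1`-decoder to the resulting `1`-block". In the code-capacity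
model (one sector of a CSS code, perfect syndrome extraction) the only datum of the block code that this recursion uses is the map
`dec : (Fin n → Bool) → Bool` sending the pattern of LOGICAL FLIPS of the `n` sub-blocks to the residual logical flip of the block after
syndrome decoding — and the only property needed is that a single flipped sub-block is always corrected
(`CorrectsSingleFlips dec`: every distance-`3` block code with a decoder correcting one arbitrary error has it; two instances are
checked below by `decide`: majority vote on `3` sub-blocks, and Hamming-syndrome decoding of the `7` sub-blocks of a Steane-code sector).

* `logicalFlip dec k x` — the residual logical flip of the level-`k` block under hierarchical decoding of the fault pattern `x`
  (level `0`: the location's own fault bit; level `k+1`: `dec` applied to the sub-blocks' level-`k` residual flips);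
* **`isBad_of_logicalFlip`** — if `dec` corrects single flips, a level-`k` logical flip forces the pattern to be BAD in the sense of
  `AGP06.IsBad` (two distinct flipped sub-blocks at the top, recursively) — AGP's "good implies correct" in this model;
* **`flipProb_le_badProb`**, **`flipProb_le_levelBound`** — hence `ℙ(logical flip at level k) ≤ ε⁽ᵏ⁾ ≤ ε₀ (p/ε₀)^{2^k}`, `ε₀ = (n choose 2)⁻¹`,
  under independent faults of rate `p` (the code-capacity CONCATENATION THRESHOLD `ε₀` for this explicit decoder, with double-exponential
  suppression below it), and the `PMF` form `prob_logicalFlip_le_levelBound`;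
* instances: `majority3` (`CorrectsSingleFlips`, threshold `1/3`: `flipProb_majority3_le`) and `steaneSector` = Hamming `[7,4,3]` syndrome
  decoding of the seven sub-block flips followed by the parity of the residual against the all-ones logical operator
  (`CorrectsSingleFlips` by `decide`; threshold `1/21`: `flipProb_steaneSector_le`).

HONEST FRAMING: code-capacity model only (faults on the `n^k` elementary locations, flawless syndrome extraction and classical processing);
one sector (bit flips) — the other sector of a CSS code is the same statement on its own fault pattern; no claim about circuit-level noise
(AGP's exRecs / malignant pairs are not modelled, cf. `ConcatenationBadnessRecursion.lean`).

## References

* [AliferisGottesmanPreskill2006] P. Aliferis, D. Gottesman, J. Preskill, Quantum Inf. Comput. 6 (2006) 97–165, §3.1 (badness; Lemma 2),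
  §3.2 (the recursive ideal decoder; "good implies correct"), §7 (Steane's [[7,1,3]] code).
-/

noncomputable section

open Finset
open scoped BigOperators ENNReal NNReal

namespace Literature.InformationTheory.QuantumCodes

namespace AGP06

variable {n : ℕ}

/-! ### The recursive decoder's logical output -/

/-- **The block decoder corrects single flips**: whenever at most one of the `n` sub-blocks carries a logical flip, the residual
logical flip of the block after decoding is `false`. [cite: AliferisGottesmanPreskill2006, §3.2 (a 1-Rec with at most one fault is correct)] -/
def CorrectsSingleFlips (dec : (Fin n → Bool) → Bool) : Prop :=
  ∀ b : Fin n → Bool, (Finset.univ.filter fun i => b i = true).card ≤ 1 → dec b = false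

/-- **The residual logical flip under hierarchical decoding** of the fault pattern `x` at level `k`: at level `0` the location's own
fault; at level `k+1`, the block decoder `dec` applied to the level-`k` residual flips of the `n` sub-blocks ("first applying the
`(k-1)`-decoder to each of the `(k-1)`-subblocks, and then applying the `1`-decoder").
[cite: AliferisGottesmanPreskill2006, §3.2 (the recursive ideal k-decoder)] -/
def logicalFlip (dec : (Fin n → Bool) → Bool) : (k : ℕ) → ((Fin k → Fin n) → Bool) → Bool
  | 0, x => x default
  | k + 1, x => dec fun i => logicalFlip dec k (subBlock x i)

/-- **Good implies correct (code-capacity model)**: if the block decoder corrects single flips, then a logical flip at level `k`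
under hierarchical decoding forces the fault pattern to be BAD (`AGP06.IsBad`: two distinct bad sub-blocks, recursively).
[cite: AliferisGottesmanPreskill2006, §3.2 (exRec-Cor / Lemma 3 "good implies correct")] -/
theorem isBad_of_logicalFlip {dec : (Fin n → Bool) → Bool} (hdec : CorrectsSingleFlips dec) :
    ∀ (k : ℕ) (x : (Fin k → Fin n) → Bool), logicalFlip dec k x = true → IsBad n k x
  | 0, x, h => by simpa [logicalFlip, IsBad] using h
  | k + 1, x, h => by
    simp only [logicalFlip] at h
    -- if at most one sub-block were flipped, `dec` would have corrected it
    by_contra hnot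
    have hcard : ¬ (Finset.univ.filter fun i => logicalFlip dec k (subBlock x i) = true).card ≤ 1 := by
      intro hle
      have := hdec _ hle
      rw [this] at h
      exact Bool.false_ne_true h
    rw [not_le, Finset.one_lt_card] at hcard
    obtain ⟨i, hi, j, hj, hij⟩ := hcard
    rw [Finset.mem_filter] at hi hj
    exact hnot ⟨i, j, hij, isBad_of_logicalFlip hdec k _ hi.2, isBad_of_logicalFlip hdec k _ hj.2⟩

/-! ### The probability of a logical flip -/

/-- The probability of a level-`k` logical flip under independent faults of rate `p`: `Σ_{x : flip} wt p k x`.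
[cite: AliferisGottesmanPreskill2006, §3.1–3.2] -/
def flipProb (dec : (Fin n → Bool) → Bool) (p : ℝ) (k : ℕ) : ℝ :=
  ∑ x : (Fin k → Fin n) → Bool, if logicalFlip dec k x = true then wt p k x else 0

/-- **`ℙ(logical flip) ≤ ε⁽ᵏ⁾`**: the flip event is contained in the badness event. [cite: AliferisGottesmanPreskill2006, §3.2] -/
theorem flipProb_le_badProb {dec : (Fin n → Bool) → Bool} (hdec : CorrectsSingleFlips dec) {p : ℝ} (hp0 : 0 ≤ p) (hp1 : p ≤ 1)
    (k : ℕ) : flipProb dec p k ≤ badProb p n k := by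
  unfold flipProb badProb
  refine Finset.sum_le_sum fun x _ => ?_
  by_cases h : logicalFlip dec k x = true
  · rw [if_pos h, if_pos (isBad_of_logicalFlip hdec k x h)]
  · rw [if_neg h]
    split_ifs
    · exact wt_nonneg hp0 hp1 k x
    · exact le_rfl

/-- **The code-capacity concatenation threshold for hierarchical decoding**: `ℙ(logical flip at level k) ≤ ε₀ (p/ε₀)^{2^k}` with
`ε₀ = (n choose 2)⁻¹`, for every block decoder that corrects single flips (`n ≥ 2`, `0 ≤ p ≤ 1`).
[cite: AliferisGottesmanPreskill2006, Lemma 2 with §3.2] -/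
theorem flipProb_le_levelBound {dec : (Fin n → Bool) → Bool} (hdec : CorrectsSingleFlips dec) {p : ℝ} (hp0 : 0 ≤ p) (hp1 : p ≤ 1)
    (hn : 2 ≤ n) (k : ℕ) : flipProb dec p k ≤ levelBound ((n.choose 2 : ℝ)⁻¹) p k :=
  (flipProb_le_badProb hdec hp0 hp1 k).trans (badProb_le_levelBound hp0 hp1 hn k)

/-- Below threshold the flip probability never exceeds `ε₀` and decays double-exponentially: `p ≤ ε₀ ⇒ ℙ(flip) ≤ ε₀ (p/ε₀)^{2^k} ≤ ε₀`.
[cite: AliferisGottesmanPreskill2006, Lemma 2 with §3.2] -/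
theorem flipProb_le_of_le_threshold {dec : (Fin n → Bool) → Bool} (hdec : CorrectsSingleFlips dec) {p : ℝ} (hp0 : 0 ≤ p)
    (hn : 2 ≤ n) (hp : p ≤ ((n.choose 2 : ℝ))⁻¹) (k : ℕ) :
    flipProb dec p k ≤ ((n.choose 2 : ℝ))⁻¹ * (p / ((n.choose 2 : ℝ))⁻¹) ^ 2 ^ k ∧ flipProb dec p k ≤ ((n.choose 2 : ℝ))⁻¹ := by
  have hA : (1 : ℝ) ≤ (n.choose 2 : ℝ) := by exact_mod_cast Nat.choose_pos hn
  have hp1 : p ≤ 1 := hp.trans (inv_le_one_of_one_le₀ hA)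
  have h := badProb_le_of_le_threshold hp0 hn hp k
  have h' := flipProb_le_badProb hdec hp0 hp1 k
  exact ⟨h'.trans h.1, h'.trans h.2⟩

/-- **`PMF` form**: under the product fault law `iidLaw (faultLaw p)`, the probability of a level-`k` logical flip under hierarchical
decoding is at most `ε₀ (p/ε₀)^{2^k}`. [cite: AliferisGottesmanPreskill2006, Lemma 2 with §3.2] -/
theorem prob_logicalFlip_le_levelBound {dec : (Fin n → Bool) → Bool} (hdec : CorrectsSingleFlips dec) (p : ℝ≥0) (hp : p ≤ 1)
    (hn : 2 ≤ n) (k : ℕ) :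
    ((iidLaw (faultLaw p hp)).toOuterMeasure {x : (Fin k → Fin n) → Bool | logicalFlip dec k x = true}).toReal ≤
      levelBound ((n.choose 2 : ℝ)⁻¹) p k := by
  refine le_trans ?_ (prob_isBad_le_levelBound p hp hn k)
  refine ENNReal.toReal_mono ?_ (MeasureTheory.OuterMeasure.mono _ fun x hx => isBad_of_logicalFlip hdec k x hx)
  refine ne_top_of_le_ne_top ENNReal.one_ne_top ?_
  calc (iidLaw (faultLaw p hp)).toOuterMeasure {x : (Fin k → Fin n) → Bool | IsBad n k x}
      ≤ (iidLaw (faultLaw p hp)).toOuterMeasure Set.univ := MeasureTheory.OuterMeasure.mono _ (Set.subset_univ _)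
    _ = 1 := (PMF.toOuterMeasure_apply_eq_one_iff _ _).2 (Set.subset_univ _)

/-! ### Instance: majority vote on three sub-blocks (threshold `1/3`) -/

/-- Majority vote on three sub-block flips (the recursive decoder of the concatenated repetition code; classical).
[cite: AliferisGottesmanPreskill2006, §3.2 (recursive decoding)] -/
def majority3 (b : Fin 3 → Bool) : Bool :=
  (b 0 && b 1) || (b 0 && b 2) || (b 1 && b 2)

/-- Majority vote corrects a single flipped sub-block. [cite: AliferisGottesmanPreskill2006, §3.2] -/
theorem correctsSingleFlips_majority3 : CorrectsSingleFlips majority3 := by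
  unfold CorrectsSingleFlips majority3
  decide

/-- **Threshold `1/3` for recursive majority voting**: `ℙ(level-k majority wrong) ≤ (1/3)·(3 p)^{2^k}` for `0 ≤ p ≤ 1/3`.
[cite: AliferisGottesmanPreskill2006, Lemma 2 with §3.2] -/
theorem flipProb_majority3_le {p : ℝ} (hp0 : 0 ≤ p) (hp : p ≤ 1 / 3) (k : ℕ) :
    flipProb majority3 p k ≤ 1 / 3 * (3 * p) ^ 2 ^ k := by
  have h3 : ((Nat.choose 3 2 : ℕ) : ℝ) = 3 := by norm_num [Nat.choose]
  have h := (flipProb_le_of_le_threshold correctsSingleFlips_majority3 hp0 (by norm_num) (by rw [h3]; simpa using hp) k).1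
  rw [h3] at h
  have e : (3 : ℝ)⁻¹ * (p / (3 : ℝ)⁻¹) ^ 2 ^ k = 1 / 3 * (3 * p) ^ 2 ^ k := by
    rw [div_inv_eq_mul, one_div, mul_comm p]
  rw [← e]
  exact h

/-! ### Instance: a Steane-code sector — Hamming `[7,4,3]` syndrome decoding of the seven sub-block flips (threshold `1/21`) -/

/-- The three Hamming parity checks of a flip pattern on `7` sub-blocks, as the number `s ∈ {0,…,7}` whose binary digits are the
check parities (position `i` participates in check `j` iff bit `j` of `i+1` is set); `s ≠ 0` names the position `s - 1` to flip back.
[cite: AliferisGottesmanPreskill2006, §7 (Steane's [[7,1,3]] code: each sector is a Hamming code)] -/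
def hammingSyndrome (b : Fin 7 → Bool) : ℕ :=
  ((Finset.univ.filter fun i : Fin 7 => b i = true ∧ (i.val + 1).testBit 0).card % 2) +
    2 * ((Finset.univ.filter fun i : Fin 7 => b i = true ∧ (i.val + 1).testBit 1).card % 2) +
    4 * ((Finset.univ.filter fun i : Fin 7 => b i = true ∧ (i.val + 1).testBit 2).card % 2)

/-- Hamming-syndrome decoding of the seven sub-block flips followed by the logical read-out: flip back the position named by the
syndrome, then report the parity of the residual against the all-ones logical operator of the Steane sector (the residual is a
Hamming codeword; it is a logical flip iff its weight is odd). [cite: AliferisGottesmanPreskill2006, §7 (Steane's [[7,1,3]] code)] -/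
def steaneSector (b : Fin 7 → Bool) : Bool :=
  let s := hammingSyndrome b
  let r : Fin 7 → Bool := fun i => if i.val + 1 = s then !(b i) else b i
  (Finset.univ.filter fun i : Fin 7 => r i = true).card % 2 = 1

set_option maxRecDepth 4096 in
/-- Hamming-syndrome decoding corrects a single flipped sub-block (checked on all `2⁷` patterns).
[cite: AliferisGottesmanPreskill2006, §7] -/
theorem correctsSingleFlips_steaneSector : CorrectsSingleFlips steaneSector := by
  unfold CorrectsSingleFlips steaneSector hammingSyndrome
  decide +kernel

/-- **Threshold `1/21` for a Steane-code sector under hierarchical decoding** (code-capacity model): `ℙ(level-k logical flip) ≤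
(1/21)·(21 p)^{2^k}` for `0 ≤ p ≤ 1/21`. [cite: AliferisGottesmanPreskill2006, Lemma 2 with §3.2 and §7] -/
theorem flipProb_steaneSector_le {p : ℝ} (hp0 : 0 ≤ p) (hp : p ≤ 1 / 21) (k : ℕ) :
    flipProb steaneSector p k ≤ 1 / 21 * (21 * p) ^ 2 ^ k := by
  have h21 : ((Nat.choose 7 2 : ℕ) : ℝ) = 21 := by norm_num [Nat.choose]
  have h := (flipProb_le_of_le_threshold correctsSingleFlips_steaneSector hp0 (by norm_num) (by rw [h21]; simpa using hp) k).1
  rw [h21] at h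
  have e : (21 : ℝ)⁻¹ * (p / (21 : ℝ)⁻¹) ^ 2 ^ k = 1 / 21 * (21 * p) ^ 2 ^ k := by
    rw [div_inv_eq_mul, one_div, mul_comm p]
  rw [← e]
  exact h

end AGP06

end Literature.InformationTheory.QuantumCodes

end
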